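/-
Origin: expansion seat `prover-pub-hodgecm-mc-discharge-3-g7-0`, handover #5 15:30Z md5 6a79464afb75 (308 l.; NEW additive KERNEL leaf, ns HodgeCM.Model.HypCensus; imports row #4 only; 0 defs, 6 theorems: `isArchWeilDatum_repTransport_cmArchWeilRep_canonical` (canonical CM frames `signSplit ∘ placeSignVec (cmRealVec …) cV`, `sqrtAbs`; left: `Nonempty (AnyLeviKAKInput γ𝕎ᵥ)` per place + sign profiles), `re_apply_eq_of_mk_eq` (`mk τ = mk σ ⇒ re τ x = re σ x`), `signProfile_of_signs_left` / `signProfile_of_signs_right` (consumer's sign facts ⇒ either-orientation profiles through every complex embedding), **`isArchWeilDatum_repTransport_cmArchWeilRep_of_signs (ι₁ hGR h₁V h₁W hV hW)`** (hypotheses of weil-2's `hasThetaMajorants_cmPairSplitting_of_signs` VERBATIM; `cV := cmSignConv L dV ι₁`, KAK kinds by `nonempty_anyLeviKAKInput_cmSignConv`), **`isArchWeilDatum_repTransport_cmArchWeilRep_of_signs_two (ι₁ hGR h₁V h₁W hV)`** (M = 2: the five binders of `hasThetaMajorants_cmPairSplitting_of_signs_two` = unitary-1 `wmInputCM₂s`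 (`WmInstanceV2` r2 :266) VERBATIM; `hW` by `signs_fin_two` + `re_apply_ne_zero_of_complexConj_eq`) — conclusion `IsArchWeilDatum (archPairPhaseHom L conj N 2 e … <canonical frames at cmSignConv>) (repTransport (scaledFrame L⁺ (Fin n) (pairScale N 2 <sqrtAbs scalings>) …) (cmArchWeilRep L e dV hdV hdV0 dW hdW hdW0 hGR))` = the (J-arch) junction of BINDER-TRIAGE §50.2 for the pin with NO archimedean datum left to supply. 0 Prop defs, 0 records, nothing cited, MODEL-N ±0, E unchanged. EVIDENCE: as row #4 (same concatenation; axioms trio on `_of_signs_two`).) (`HOME/mc/pub-hodgecm-mc-discharge-3/stage/HodgeCM/Model/HypCensus/ArchDatumPlacesCMSigns.lean`, md5 6a79464a, 307 lines);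
landed by the gen-12 packager (p-g12) in gate run 36 as `HodgeCM/Model/HypCensus/ArchDatumPlacesCMSigns.lean` (verbatim).
-/
/-
Origin: speedrun cell pub-hodgecm, MODEL-CONSTRUCTION sub-cell, discharge seat mc-discharge-3 (unit pub-hodgecm-mc-discharge-3,
seat prover-pub-hodgecm-mc-discharge-3-g7-0, gen 7), ticket D-3 = BINDER-OWNERS §1a rows 10/16/17 sub-items (c2)+(c4) of binder-2's
`archWeilRep` ((J-arch) §3(b)/(c)) AT THE CM PIN, consumer's form, 2026-08-19.
Target in PKG: `HodgeCM/Model/HypCensus/ArchDatumPlacesCMSigns.lean` (NEW additive leaf = D-3 kit row #5; imports `ArchDatumPlacesCM`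
(row #4)).  KERNEL only: 0 records / named facts / defs, 0 proof holes.  Checked against the hub tree by concatenation with
`ArchFactor.lean` 55e596e2a0dc / `ArchDatum.lean` 13e0d54cb896 / `ArchDatumCoeff` cf854e6a9240 / `ArchDatumLift` f72d05db6f7c /
`ArchDatumPlaces` ed5134ac1dcf / `ArchDatumCM` 6b7b14981f04 / `ArchDatumPlacesCM` (imports de-vendored), farm rc 0.
-/
import Summits.HodgeConjecture.HodgeCM.Model.HypCensus.ArchDatumPlacesCM

/-!
# Census kit (rows A12/A34), junction (J-arch) at the CM pin — the consumer's form: sign facts through complex embeddings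

Continuation of `ArchDatumPlacesCM` (§1 either-orientation profiles, §2 canonical frames, §3 the CM pin with frames supplied).
Here the last two steps of weil-2's chain (`hasThetaMajorants_cmPairSplitting_canonical → _of_signs → _of_signs_two`,
`Weil1964/ArchDualPairThetaMajorants` §2) for `IsArchWeilDatum`:

* `isArchWeilDatum_repTransport_cmArchWeilRep_canonical` — CANONICAL frames at the CM pin (`signSplit ∘ placeSignVec (cmRealVec …) c_V`,
  scalings `√|·|`), one kind-erased Levi-form `KAK` input per place and the sign profiles left to supply;
* **`isArchWeilDatum_repTransport_cmArchWeilRep_of_signs`** / **`…_of_signs_two`** — from SIGN FACTS through complex embeddings ONLY,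
  hypotheses `(ι₁ hGR h₁V h₁W hV [hW])` = those of `hasThetaMajorants_cmPairSplitting_of_signs[_two]` VERBATIM (the `hρ` input of
  unitary-1's `wmInputCM₂s`, `Model/WmInstanceV2`; fed at the pin by `frameD_sign_ι₁'`, `frameD_sign_of_ne` and E's `h₁W`): the
  (J-arch) datum of BINDER-TRIAGE §50.2 — (w1) strong continuity, (w2) exact Heisenberg covariance, (w2′) unitary lifts — for
  binder-2's `cmArchWeilRep L e dV … hGR` in the scaled Folland frame of the canonical sign frames (`cmSignConv`), over the product
  phase homomorphism `archPairPhaseHom …` of Konno–Konno's real pairs, with NO hypothesis on `archWeilRep` and no archimedean datum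
  left to supply;
* dictionary lemmas `re_apply_eq_of_mk_eq` (real parts agree on an infinite place), `signProfile_of_signs_left/right` (the
  consumer's sign facts ⇒ the either-orientation profiles through every complex embedding).

Nothing here is a claim of PerL/QW8. [Folland1989, §4.2, the Schur remark p. 156; Weil1964, Chap. III n° 37–39] is the provenance
of the argument.  Style lint (L-notation): ONE `local notation` `γ𝕎[P, Q, R, S]` (as in the tree file `ArchDualPairThetaMajorants`),
its right-hand side captures NO section variable.
-/

set_option autoImplicit false

noncomputable section

open NumberField NumberField.InfinitePlace IsDedekindDomain MeasureTheory
open scoped Matrix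
open scoped Kronecker Classical TensorProduct ComplexConjugate
open Literature.NumberTheory.Automorphic Literature.NumberTheory.Automorphic.UnitaryGroup Literature.NumberTheory.Weil1964
open Literature.RepresentationTheory.HeisenbergGroup (polar Heisenberg symplecticGroup ofSymplectic)
open Literature.RepresentationTheory.KonnoKonno2007 Literature.RepresentationTheory.KonnoKonno2007.RealDualPair
open Literature.NumberTheory.GelbartRogawski1991 Literature.NumberTheory.GelbartRogawski1991.UnitaryDualPair
open Literature.Analysis.SegalBargmann

-- Notation (NOT a definition), as in `Weil1964/ArchDualPairThetaMajorants`: the archimedean symplectic action of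
-- `G_∞ = U(P,Q) × U(R,S)` on the polarised phase space, as phase maps.  Captures no section variable.
set_option quotPrecheck false in
local notation "γ𝕎[" P ", " Q ", " R ", " S "]" =>
  fun g : Ginf P Q R S => (⇑((ι𝕎 P Q R S g).1 :
    ((DPIdx P Q R S → ℝ) × (DPIdx P Q R S → ℝ)) ≃ₗ[ℝ] ((DPIdx P Q R S → ℝ) × (DPIdx P Q R S → ℝ))) :
      PhaseMap (DPIdx P Q R S))

namespace HodgeCM.Model.HypCensus

/-! ## §4 The CM pin, canonical frames; the consumer's form -/

section CMPin

variable (L : Type) [Field L] [NumberField L] [IsCMField L] {N M n : ℕ} (e : Fin N × Fin M ≃ Fin n)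
variable (dV : Fin N → L) (hdV : ∀ i, IsCMField.complexConj L (dV i) = dV i) (hdV0 : ∀ i, dV i ≠ 0)
variable (dW : Fin M → L) (hdW : ∀ i, IsCMField.complexConj L (dW i) = dW i) (hdW0 : ∀ i, dW i ≠ 0)
variable (hGR : (cmSplittingDatum L e dV hdV hdV0 dW hdW hdW0).CompatibleSplitting)

/-- **The (J-arch) datum of the CM pin, CANONICAL FRAMES**: the consumer chooses a nowhere-zero `c_V`; the real pair at `v` is
`U(PosIdx x_V, NegIdx x_V) × U(PosIdx x_W, NegIdx x_W)`, `x_V = σ_v(d_V)/c_V(v)`, `x_W = σ_v(d_W) c_V(v)/im σ_{w(v)}(δ_L)`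
(`placeSignVec (cmRealVec …)`), scalings `√|·|`; it remains to give `Nonempty (AnyLeviKAKInput γ𝕎ᵥ)` per place
(`nonempty_anyLeviKAKInput_of_card_le_one` / `_of_compact_left`) and the sign profiles through complex embeddings.
[Folland1989, §4.2, the Schur remark p. 156, (4.24), Prop. (4.39); Knapp2002, Thm 7.39; GelbartRogawski1991, §3.1 Prop. 3.1.1
p. 455; MoeglinVignerasWaldspurger1987, Ch. 1 I.17; Weil1964, Chap. III n° 37–39] -/
theorem isArchWeilDatum_repTransport_cmArchWeilRep_canonical
    (cV : {v : InfinitePlace ↥(maximalRealSubfield L) // v.IsReal} → ℝ) (hcV : ∀ v, cV v ≠ 0)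
    (hI : ∀ v, Nonempty (AnyLeviKAKInput
      (γ𝕎[PosIdx (placeSignVec (cmRealVec L dV hdV) cV v), NegIdx (placeSignVec (cmRealVec L dV hdV) cV v),
        PosIdx (placeSignVec (cmRealVec L dW hdW) (fun v =>
          ((cmPlaceOver L v).1.embedding (imagUnit L)).im / cV v) v),
        NegIdx (placeSignVec (cmRealVec L dW hdW) (fun v =>
          ((cmPlaceOver L v).1.embedding (imagUnit L)).im / cV v) v)])))
    (hsV : ∀ τ : L →+* ℂ,
      ((∃ i₀, ∀ i, i ≠ i₀ → 0 < (τ (dV i)).re) ∨ ∀ i, (τ (dV i)).re < 0) ∨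
        ((∃ i₀, ∀ i, i ≠ i₀ → (τ (dV i)).re < 0) ∨ ∀ i, 0 < (τ (dV i)).re))
    (hsW : ∀ τ : L →+* ℂ,
      ((∃ j₀, ∀ j, j ≠ j₀ → 0 < (τ (dW j)).re) ∨ ∀ j, (τ (dW j)).re < 0) ∨
        ((∃ j₀, ∀ j, j ≠ j₀ → (τ (dW j)).re < 0) ∨ ∀ j, 0 < (τ (dW j)).re)) :
    IsArchWeilDatum
      (archPairPhaseHom L (IsCMField.complexConj L) N M e (IsCMField.complexConj_ne_one L) (cmPlaceOver L)
        (cmPlaceOver_smul L) (cmPlaceOver_comap L) (cmRealVec L dV hdV) (cmRealVec L dW hdW)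
        (realDiagonal_map L dV hdV).symm
        (realDiagonal_map L dW hdW).symm
        (fun v => signSplit (placeSignVec (cmRealVec L dV hdV) cV v))
        (fun v => signSplit (placeSignVec (cmRealVec L dW hdW) (fun v =>
          ((cmPlaceOver L v).1.embedding (imagUnit L)).im / cV v) v))
        (DV := fun v => sqrtAbs (placeSignVec (cmRealVec L dV hdV) cV v))
        (DW := fun v => sqrtAbs (placeSignVec (cmRealVec L dW hdW) (fun v =>
          ((cmPlaceOver L v).1.embedding (imagUnit L)).im / cV v) v))
        (fun v i => sqrtAbs_ne_zero (div_ne_zero ((map_ne_zero _).2 (ne_zero_of_isUnit_det_diagonal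
          (isUnit_det_realDiagonal L dV hdV hdV0) i)) (hcV v)))
        (fun v j => sqrtAbs_ne_zero (div_ne_zero ((map_ne_zero _).2 (ne_zero_of_isUnit_det_diagonal
          (isUnit_det_realDiagonal L dW hdW hdW0) j))
          (div_ne_zero (im_embedding_cmPlaceOver_imagUnit_ne_zero L v) (hcV v))))
        (cV := cV)
        (cW := fun v => ((cmPlaceOver L v).1.embedding (imagUnit L)).im / cV v) hcV
        (fun v => div_ne_zero (im_embedding_cmPlaceOver_imagUnit_ne_zero L v) (hcV v))
        (fun v i => eq_mul_signOf_signSplit_mul_sqrtAbs_sq (hcV v) (fun j => embedding_of_isReal v.2 (cmRealVec L dV hdV j)) i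
          ((map_ne_zero _).2 (ne_zero_of_isUnit_det_diagonal
            (isUnit_det_realDiagonal L dV hdV hdV0) i)))
        (fun v j => eq_mul_signOf_signSplit_mul_sqrtAbs_sq
          (div_ne_zero (im_embedding_cmPlaceOver_imagUnit_ne_zero L v) (hcV v))
          (fun j => embedding_of_isReal v.2 (cmRealVec L dW hdW j)) j
          ((map_ne_zero _).2 (ne_zero_of_isUnit_det_diagonal
            (isUnit_det_realDiagonal L dW hdW hdW0) j))))
      (repTransport
        (scaledFrame (↥(maximalRealSubfield L)) (Fin n)
          (pairScale N M (e := e) (fun v => sqrtAbs (placeSignVec (cmRealVec L dV hdV) cV v))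
            (fun v => sqrtAbs (placeSignVec (cmRealVec L dW hdW) (fun v =>
              ((cmPlaceOver L v).1.embedding (imagUnit L)).im / cV v) v)))
          (pairScale_ne_zero N M
            (fun v i => sqrtAbs_ne_zero (div_ne_zero ((map_ne_zero _).2 (ne_zero_of_isUnit_det_diagonal
              (isUnit_det_realDiagonal L dV hdV hdV0) i)) (hcV v)))
            (fun v j => sqrtAbs_ne_zero (div_ne_zero ((map_ne_zero _).2 (ne_zero_of_isUnit_det_diagonal
              (isUnit_det_realDiagonal L dW hdW hdW0) j))
              (div_ne_zero (im_embedding_cmPlaceOver_imagUnit_ne_zero L v) (hcV v))))))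
        (cmArchWeilRep L e dV hdV hdV0 dW hdW hdW0 hGR)) :=
  isArchWeilDatum_repTransport_cmArchWeilRep_of_nonempty L e dV hdV hdV0 dW hdW hdW0 hGR _ _ _ _ hcV _ _ _
    (fun v => by rw [← mul_div_assoc, mul_div_cancel_left₀ _ (hcV v)]) hI hsV hsW

/-! ### The consumer's form: sign facts through complex embeddings -/

omit [NumberField L] [IsCMField L] in
/-- real parts through two complex embeddings defining the same infinite place agree. [folklore] -/
theorem re_apply_eq_of_mk_eq {τ σ : L →+* ℂ} (h : InfinitePlace.mk τ = InfinitePlace.mk σ) (x : L) :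
    (τ x).re = (σ x).re := by
  rcases mk_eq_iff.1 h with h | h
  · rw [h]
  · rw [← h, ComplexEmbedding.conjugate_coe_eq, Complex.conj_re]

omit [NumberField L] [IsCMField L] in
/-- the `V`-side sign facts of the consumer's form (signature `(N−1,1)` or `(1,N−1)` at the place of `ι₁`, definite elsewhere)
give the profile «at most one entry of the minority sign, either orientation» through EVERY complex embedding. [folklore] -/
theorem signProfile_of_signs_left {K : ℕ} (d : Fin K → L) (ι₁ : L →+* ℂ)
    (h₁ : ∃ i₀ : Fin K, (∀ i, i ≠ i₀ → 0 < (ι₁ (d i)).re) ∨ ∀ i, i ≠ i₀ → (ι₁ (d i)).re < 0)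
    (h : ∀ τ : L →+* ℂ, InfinitePlace.mk τ ≠ InfinitePlace.mk ι₁ → (∀ i, 0 < (τ (d i)).re) ∨ ∀ i, (τ (d i)).re < 0)
    (τ : L →+* ℂ) :
    ((∃ i₀, ∀ i, i ≠ i₀ → 0 < (τ (d i)).re) ∨ ∀ i, (τ (d i)).re < 0) ∨
      ((∃ i₀, ∀ i, i ≠ i₀ → (τ (d i)).re < 0) ∨ ∀ i, 0 < (τ (d i)).re) := by
  by_cases hτ : InfinitePlace.mk τ = InfinitePlace.mk ι₁
  · obtain ⟨i₀, h₁ | h₁⟩ := h₁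
    · exact Or.inl (Or.inl ⟨i₀, fun i hi => by rw [re_apply_eq_of_mk_eq L hτ]; exact h₁ i hi⟩)
    · exact Or.inr (Or.inl ⟨i₀, fun i hi => by rw [re_apply_eq_of_mk_eq L hτ]; exact h₁ i hi⟩)
  · rcases h τ hτ with h | h
    · exact Or.inr (Or.inr h)
    · exact Or.inl (Or.inr h)

omit [NumberField L] [IsCMField L] in
/-- the `W`-side sign facts of the consumer's form (definite at the place of `ι₁`; at most one non-positive entry or negative
definite elsewhere) give the same profile through EVERY complex embedding. [folklore] -/
theorem signProfile_of_signs_right {K : ℕ} (d : Fin K → L) (ι₁ : L →+* ℂ)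
    (h₁ : (∀ j, 0 < (ι₁ (d j)).re) ∨ ∀ j, (ι₁ (d j)).re < 0)
    (h : ∀ τ : L →+* ℂ, InfinitePlace.mk τ ≠ InfinitePlace.mk ι₁ →
      (∃ j₀ : Fin K, ∀ j, j ≠ j₀ → 0 < (τ (d j)).re) ∨ ∀ j, (τ (d j)).re < 0)
    (τ : L →+* ℂ) :
    ((∃ j₀, ∀ j, j ≠ j₀ → 0 < (τ (d j)).re) ∨ ∀ j, (τ (d j)).re < 0) ∨
      ((∃ j₀, ∀ j, j ≠ j₀ → (τ (d j)).re < 0) ∨ ∀ j, 0 < (τ (d j)).re) := by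
  by_cases hτ : InfinitePlace.mk τ = InfinitePlace.mk ι₁
  · rcases h₁ with h₁ | h₁
    · exact Or.inr (Or.inr fun j => by rw [re_apply_eq_of_mk_eq L hτ]; exact h₁ j)
    · exact Or.inl (Or.inr fun j => by rw [re_apply_eq_of_mk_eq L hτ]; exact h₁ j)
  · exact Or.inl (h τ hτ)

/-- **The (J-arch) datum of the CM pin from SIGN FACTS through complex embeddings — the consumer's form (no frames, no scalings,
no `KAK` data).**  Fix a complex embedding `ι₁` of the CM field `L`.  Suppose that through `ι₁` all but one of the (real,
non-zero) numbers `ι₁(d_V i)` have a common strict sign and the `ι₁(d_W j)` have a common strict sign — the real pair at the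
place under `ι₁` is `U(N−1,1) × U(M,0)` up to orientation — and that through every complex embedding `τ` at another place the
`τ(d_V i)` have a common strict sign and all but at most one of the `τ(d_W j)` are positive, or all are negative.  Then the
archimedean Weil representation `cmArchWeilRep L e dV … hGR` of binder-2's `ArchDatumCM` (= `ω_ψ ∘ cmPairSplitting hGR` on
archimedean pair elements, `omega_cmPairSplitting_arch_map_tmul`), transported to the scaled Folland frame of the canonical sign
frames (`cmSignConv`), IS an archimedean Weil datum over the product phase homomorphism `archPairPhaseHom …` of Konno–Konno's
real pairs: (w1) strong continuity, (w2) exact Heisenberg covariance, (w2′) unitary lifts — the (J-arch) junction of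
BINDER-TRIAGE §50.2, hypotheses = those of `hasThetaMajorants_cmPairSplitting_of_signs` VERBATIM.
[Folland1989, §4.2, the Schur remark p. 156, (4.24), Prop. (4.39); Knapp2002, Thm 7.39; GelbartRogawski1991, §3.1 Prop. 3.1.1
p. 455; KonnoKonno2007, §3.1 (3.1); MoeglinVignerasWaldspurger1987, Ch. 1 I.17; Weil1964, Chap. III n° 37–39] -/
theorem isArchWeilDatum_repTransport_cmArchWeilRep_of_signs (ι₁ : L →+* ℂ)
    (h₁V : ∃ i₀ : Fin N, (∀ i, i ≠ i₀ → 0 < (ι₁ (dV i)).re) ∨ ∀ i, i ≠ i₀ → (ι₁ (dV i)).re < 0)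
    (h₁W : (∀ j, 0 < (ι₁ (dW j)).re) ∨ ∀ j, (ι₁ (dW j)).re < 0)
    (hV : ∀ τ : L →+* ℂ, InfinitePlace.mk τ ≠ InfinitePlace.mk ι₁ →
      (∀ i, 0 < (τ (dV i)).re) ∨ ∀ i, (τ (dV i)).re < 0)
    (hW : ∀ τ : L →+* ℂ, InfinitePlace.mk τ ≠ InfinitePlace.mk ι₁ →
      (∃ j₀ : Fin M, ∀ j, j ≠ j₀ → 0 < (τ (dW j)).re) ∨ ∀ j, (τ (dW j)).re < 0) :
    IsArchWeilDatum
      (archPairPhaseHom L (IsCMField.complexConj L) N M e (IsCMField.complexConj_ne_one L) (cmPlaceOver L)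
        (cmPlaceOver_smul L) (cmPlaceOver_comap L) (cmRealVec L dV hdV) (cmRealVec L dW hdW)
        (realDiagonal_map L dV hdV).symm
        (realDiagonal_map L dW hdW).symm
        (fun v => signSplit (placeSignVec (cmRealVec L dV hdV) (cmSignConv L dV ι₁) v))
        (fun v => signSplit (placeSignVec (cmRealVec L dW hdW) (fun v =>
          ((cmPlaceOver L v).1.embedding (imagUnit L)).im / cmSignConv L dV ι₁ v) v))
        (DV := fun v => sqrtAbs (placeSignVec (cmRealVec L dV hdV) (cmSignConv L dV ι₁) v))
        (DW := fun v => sqrtAbs (placeSignVec (cmRealVec L dW hdW) (fun v =>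
          ((cmPlaceOver L v).1.embedding (imagUnit L)).im / cmSignConv L dV ι₁ v) v))
        (fun v i => sqrtAbs_ne_zero (div_ne_zero ((map_ne_zero _).2 (ne_zero_of_isUnit_det_diagonal
          (isUnit_det_realDiagonal L dV hdV hdV0) i)) (cmSignConv_ne_zero L dV ι₁ v)))
        (fun v j => sqrtAbs_ne_zero (div_ne_zero ((map_ne_zero _).2 (ne_zero_of_isUnit_det_diagonal
          (isUnit_det_realDiagonal L dW hdW hdW0) j))
          (div_ne_zero (im_embedding_cmPlaceOver_imagUnit_ne_zero L v) (cmSignConv_ne_zero L dV ι₁ v))))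
        (cV := cmSignConv L dV ι₁)
        (cW := fun v => ((cmPlaceOver L v).1.embedding (imagUnit L)).im /
          cmSignConv L dV ι₁ v) (cmSignConv_ne_zero L dV ι₁)
        (fun v => div_ne_zero (im_embedding_cmPlaceOver_imagUnit_ne_zero L v) (cmSignConv_ne_zero L dV ι₁ v))
        (fun v i => eq_mul_signOf_signSplit_mul_sqrtAbs_sq (cmSignConv_ne_zero L dV ι₁ v)
          (fun j => embedding_of_isReal v.2 (cmRealVec L dV hdV j)) i
          ((map_ne_zero _).2 (ne_zero_of_isUnit_det_diagonal
            (isUnit_det_realDiagonal L dV hdV hdV0) i)))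
        (fun v j => eq_mul_signOf_signSplit_mul_sqrtAbs_sq
          (div_ne_zero (im_embedding_cmPlaceOver_imagUnit_ne_zero L v) (cmSignConv_ne_zero L dV ι₁ v))
          (fun j => embedding_of_isReal v.2 (cmRealVec L dW hdW j)) j
          ((map_ne_zero _).2 (ne_zero_of_isUnit_det_diagonal
            (isUnit_det_realDiagonal L dW hdW hdW0) j))))
      (repTransport
        (scaledFrame (↥(maximalRealSubfield L)) (Fin n)
          (pairScale N M (e := e) (fun v => sqrtAbs (placeSignVec (cmRealVec L dV hdV) (cmSignConv L dV ι₁) v))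
            (fun v => sqrtAbs (placeSignVec (cmRealVec L dW hdW) (fun v =>
              ((cmPlaceOver L v).1.embedding (imagUnit L)).im /
                cmSignConv L dV ι₁ v) v)))
          (pairScale_ne_zero N M
            (fun v i => sqrtAbs_ne_zero (div_ne_zero ((map_ne_zero _).2 (ne_zero_of_isUnit_det_diagonal
              (isUnit_det_realDiagonal L dV hdV hdV0) i)) (cmSignConv_ne_zero L dV ι₁ v)))
            (fun v j => sqrtAbs_ne_zero (div_ne_zero ((map_ne_zero _).2 (ne_zero_of_isUnit_det_diagonal
              (isUnit_det_realDiagonal L dW hdW hdW0) j))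
              (div_ne_zero (im_embedding_cmPlaceOver_imagUnit_ne_zero L v) (cmSignConv_ne_zero L dV ι₁ v))))))
        (cmArchWeilRep L e dV hdV hdV0 dW hdW hdW0 hGR)) :=
  isArchWeilDatum_repTransport_cmArchWeilRep_canonical L e dV hdV hdV0 dW hdW hdW0 hGR (cmSignConv L dV ι₁)
    (cmSignConv_ne_zero L dV ι₁) (nonempty_anyLeviKAKInput_cmSignConv L dV hdV dW hdW ι₁ h₁V h₁W hV hW)
    (signProfile_of_signs_left L dV ι₁ h₁V hV) (signProfile_of_signs_right L dW ι₁ h₁W hW)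

end CMPin

section CMPlane

variable (L : Type) [Field L] [NumberField L] [IsCMField L] {N n : ℕ} (e : Fin N × Fin 2 ≃ Fin n)
  (dV : Fin N → L) (hdV : ∀ i, IsCMField.complexConj L (dV i) = dV i) (hdV0 : ∀ i, dV i ≠ 0)
  (dW : Fin 2 → L) (hdW : ∀ i, IsCMField.complexConj L (dW i) = dW i) (hdW0 : ∀ i, dW i ≠ 0)
  (hGR : (cmSplittingDatum L e dV hdV hdV0 dW hdW hdW0).CompatibleSplitting)

/-- **The (J-arch) datum of the CM pin for a hermitian PLANE `W = ⟨d_W 0⟩ ⊕ ⟨d_W 1⟩`** (`M = 2`; the pub-hodgecm model's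
`U(V) × U(W₁ ⊕ W₂)`, `N = 3`): away from the distinguished embedding `ι₁` NO hypothesis on `W` is needed (`signs_fin_two`), so the
input is: `V` of signature `(N−1,1)` or `(1,N−1)` and `W` definite through `ι₁`, `V` definite through every other embedding — the
binders `(ι₁ hGR h₁V h₁W hV)` of `hasThetaMajorants_cmPairSplitting_of_signs_two` / unitary-1's `wmInputCM₂s` VERBATIM.
[Folland1989, §4.2, the Schur remark p. 156, (4.24), Prop. (4.39); Knapp2002, Thm 7.39; GelbartRogawski1991, §3.1 Prop. 3.1.1
p. 455; KonnoKonno2007, §3.1 (3.1); MoeglinVignerasWaldspurger1987, Ch. 1 I.17; Weil1964, Chap. III n° 37–39] -/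
theorem isArchWeilDatum_repTransport_cmArchWeilRep_of_signs_two (ι₁ : L →+* ℂ)
    (h₁V : ∃ i₀ : Fin N, (∀ i, i ≠ i₀ → 0 < (ι₁ (dV i)).re) ∨ ∀ i, i ≠ i₀ → (ι₁ (dV i)).re < 0)
    (h₁W : (∀ j, 0 < (ι₁ (dW j)).re) ∨ ∀ j, (ι₁ (dW j)).re < 0)
    (hV : ∀ τ : L →+* ℂ, InfinitePlace.mk τ ≠ InfinitePlace.mk ι₁ →
      (∀ i, 0 < (τ (dV i)).re) ∨ ∀ i, (τ (dV i)).re < 0) :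
    IsArchWeilDatum
      (archPairPhaseHom L (IsCMField.complexConj L) N 2 e (IsCMField.complexConj_ne_one L) (cmPlaceOver L)
        (cmPlaceOver_smul L) (cmPlaceOver_comap L) (cmRealVec L dV hdV) (cmRealVec L dW hdW)
        (realDiagonal_map L dV hdV).symm
        (realDiagonal_map L dW hdW).symm
        (fun v => signSplit (placeSignVec (cmRealVec L dV hdV) (cmSignConv L dV ι₁) v))
        (fun v => signSplit (placeSignVec (cmRealVec L dW hdW) (fun v =>
          ((cmPlaceOver L v).1.embedding (imagUnit L)).im / cmSignConv L dV ι₁ v) v))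
        (DV := fun v => sqrtAbs (placeSignVec (cmRealVec L dV hdV) (cmSignConv L dV ι₁) v))
        (DW := fun v => sqrtAbs (placeSignVec (cmRealVec L dW hdW) (fun v =>
          ((cmPlaceOver L v).1.embedding (imagUnit L)).im / cmSignConv L dV ι₁ v) v))
        (fun v i => sqrtAbs_ne_zero (div_ne_zero ((map_ne_zero _).2 (ne_zero_of_isUnit_det_diagonal
          (isUnit_det_realDiagonal L dV hdV hdV0) i)) (cmSignConv_ne_zero L dV ι₁ v)))
        (fun v j => sqrtAbs_ne_zero (div_ne_zero ((map_ne_zero _).2 (ne_zero_of_isUnit_det_diagonal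
          (isUnit_det_realDiagonal L dW hdW hdW0) j))
          (div_ne_zero (im_embedding_cmPlaceOver_imagUnit_ne_zero L v) (cmSignConv_ne_zero L dV ι₁ v))))
        (cV := cmSignConv L dV ι₁)
        (cW := fun v => ((cmPlaceOver L v).1.embedding (imagUnit L)).im /
          cmSignConv L dV ι₁ v) (cmSignConv_ne_zero L dV ι₁)
        (fun v => div_ne_zero (im_embedding_cmPlaceOver_imagUnit_ne_zero L v) (cmSignConv_ne_zero L dV ι₁ v))
        (fun v i => eq_mul_signOf_signSplit_mul_sqrtAbs_sq (cmSignConv_ne_zero L dV ι₁ v)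
          (fun j => embedding_of_isReal v.2 (cmRealVec L dV hdV j)) i
          ((map_ne_zero _).2 (ne_zero_of_isUnit_det_diagonal
            (isUnit_det_realDiagonal L dV hdV hdV0) i)))
        (fun v j => eq_mul_signOf_signSplit_mul_sqrtAbs_sq
          (div_ne_zero (im_embedding_cmPlaceOver_imagUnit_ne_zero L v) (cmSignConv_ne_zero L dV ι₁ v))
          (fun j => embedding_of_isReal v.2 (cmRealVec L dW hdW j)) j
          ((map_ne_zero _).2 (ne_zero_of_isUnit_det_diagonal
            (isUnit_det_realDiagonal L dW hdW hdW0) j))))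
      (repTransport
        (scaledFrame (↥(maximalRealSubfield L)) (Fin n)
          (pairScale N 2 (e := e) (fun v => sqrtAbs (placeSignVec (cmRealVec L dV hdV) (cmSignConv L dV ι₁) v))
            (fun v => sqrtAbs (placeSignVec (cmRealVec L dW hdW) (fun v =>
              ((cmPlaceOver L v).1.embedding (imagUnit L)).im /
                cmSignConv L dV ι₁ v) v)))
          (pairScale_ne_zero N 2
            (fun v i => sqrtAbs_ne_zero (div_ne_zero ((map_ne_zero _).2 (ne_zero_of_isUnit_det_diagonal
              (isUnit_det_realDiagonal L dV hdV hdV0) i)) (cmSignConv_ne_zero L dV ι₁ v)))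
            (fun v j => sqrtAbs_ne_zero (div_ne_zero ((map_ne_zero _).2 (ne_zero_of_isUnit_det_diagonal
              (isUnit_det_realDiagonal L dW hdW hdW0) j))
              (div_ne_zero (im_embedding_cmPlaceOver_imagUnit_ne_zero L v) (cmSignConv_ne_zero L dV ι₁ v))))))
        (cmArchWeilRep L e dV hdV hdV0 dW hdW hdW0 hGR)) :=
  isArchWeilDatum_repTransport_cmArchWeilRep_of_signs L e dV hdV hdV0 dW hdW hdW0 hGR ι₁ h₁V h₁W hV fun τ _ =>
    signs_fin_two fun j => re_apply_ne_zero_of_complexConj_eq L τ (hdW j) (hdW0 j)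

end CMPlane

end HodgeCM.Model.HypCensus

end
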